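import Summits.AtomisticToContinuum.Crystallization.Cruxes.TruncatedCensusGap.IdeatorThreeSketch

/-!
# crux-triage r1, triager 1 — Lean evidence (stmt-AtomisticToContinuum-14230, `TruncatedCensusGap`)

Companion of `TRIAGE-r1-1.md`.  Sorry-free.

## Finding: `Sketch.SlackStability` (card gap-distance-slack, "energy-side crux in checkable form") is vacuous as typed

It is implied by bare periodic stability `BddBelow (range e_χ)` — the `κ = 0` bookkeeping of the crux
(`Theorems/TruncatedCensusGap/Negative/KappaZeroHalf.lean`, `truncatedCensusGap_kappa_zero_iff_bddBelow`) — in two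
independent ways:
* `slackStability_of_bddBelow`  : `P = 0`, `W = ∅` — the shape constraint
  `c * min 1 ((⨅ w : W, max 0 (|r - w| - a/250))^2) ≤ P r` collapses because `⨅` over the EMPTY index type is `0`;
* `slackStability_of_bddBelow'` : `P = 0`, `W = {1}`, `a = 1000` — the window scale `a` is only asked to be positive, so
  one window swallows `[17/20, 2]`.
A corrected signature (absolute half-width `1/250`, vacuity-proof lower bound `∀ δ ∈ (0,1], (∀ w ∈ W, 1/250 + δ ≤ |r-w|)
→ c δ² ≤ P r` on `(0, 2]`) is in `TRIAGE-r1-1.md`.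
-/

noncomputable section

namespace Summit.AtomisticToContinuum.Crystallization.Cruxes.TruncatedCensusGap.TriageR1K1

open Literature.MathematicalPhysics.StatisticalMechanics Literature.Geometry.DiscreteGeometry
open Summit.AtomisticToContinuum.Crystallization.Cruxes.TruncatedCensusGap.Sketch

/-- `SlackStability` from periodic stability alone: `P = 0`, `W = ∅`. -/
theorem slackStability_of_bddBelow
    (hB : BddBelow (Set.range fun Q : PeriodicConfiguration 3 => Q.energyPerParticle Vχ)) :
    SlackStability := by
  refine ⟨fun _ => 0, 1, 1, ∅, one_pos, one_pos, by simp, continuous_const, fun _ => le_rfl,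
    fun _ _ => rfl, ?_, ?_, ?_⟩
  · intro r _ _
    haveI : IsEmpty ((∅ : Finset ℝ) : Type) := ⟨fun x => Finset.notMem_empty _ x.2⟩
    have h0 : (⨅ w : ((∅ : Finset ℝ) : Type), max 0 (|r - (w : ℝ)| - 1 / 250)) = 0 :=
      Real.iInf_of_isEmpty _
    rw [h0]
    norm_num
  · simpa using hB
  · simp only [sub_zero]
    rfl

/-- `SlackStability` from periodic stability alone, with a NONEMPTY window set: `P = 0`, `W = {1}`,
`a = 1000`. -/
theorem slackStability_of_bddBelow'
    (hB : BddBelow (Set.range fun Q : PeriodicConfiguration 3 => Q.energyPerParticle Vχ)) :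
    SlackStability := by
  refine ⟨fun _ => 0, 1000, 1, {1}, by norm_num, one_pos, by simp, continuous_const,
    fun _ => le_rfl, fun _ _ => rfl, ?_, ?_, ?_⟩
  · intro r hr1 hr2
    have hval : ∀ w : (({1} : Finset ℝ) : Type), max 0 (|r - (w : ℝ)| - 1000 / 250) = 0 := by
      intro w
      have hw : (w : ℝ) = 1 := Finset.mem_singleton.1 w.2
      rw [hw]
      apply max_eq_left
      have : |r - 1| ≤ 1 := abs_le.2 ⟨by linarith, by linarith⟩
      linarith
    have h0 : (⨅ w : (({1} : Finset ℝ) : Type), max 0 (|r - (w : ℝ)| - 1000 / 250)) = 0 := by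
      simp only [hval, Real.iInf_const_zero]
    rw [h0]
    norm_num
  · simpa using hB
  · simp only [sub_zero]
    rfl

end Summit.AtomisticToContinuum.Crystallization.Cruxes.TruncatedCensusGap.TriageR1K1

end
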